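import Summits.CriticalPhenomena.PercolationContinuityZ3.Theorems.PercNearOneGluingNoHeavyLowerTailCILTwoSteinerSeriesTools
import HarnessLib

/-!
# `NoHeavyLowerTail` (stmt-CriticalPhenomena-4575) — transport identities for the series-reduced graph, EVENT-GLUING form

Support file (prover `prim-hp-2`, deletion–contraction line; `--supports stmt-CriticalPhenomena-4575`).  No definitions, no named
facts, no sorries.  Notation as in `…CILTwoSteinerSeriesTools.lean` (`w⁰ = G − o`, `e = s(o,x)`, `f = s(o,y)`, `g = s(x,y)`, series-
reduced graph `w₃`) with a fixed sink vertex `b ≠ o` and the event-gluing observer event `EG-L_v = {v ↔ A} ∩ {v ↮ b}`,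
detachment event `EG-R_a = {a ↮ b}` (on a uniform star sink these integrate to the geometric-moment polynomials `L(v)`, `R_a(v)`).

* `real_EGL_update_wzero_one` — `μ_{w⁰[e↦1]}(EG-L_o) = μ_{w⁰}(EG-L_x)`;
* `real_EGL_update_wzero_one_one` — `μ_{w⁰[e↦1][f↦1]}(EG-L_o) = μ_{w⁰[g↦1]}(EG-L_x)` (any weight of `g`);
* `detach_seriesReduced` — `μ_w(a ↮ b) = μ_{w₃}(a ↮ b)` for every `a ≠ o` (`HullPort.series_reduction` with the one-point
  terminal set `{b}`).
The event-gluing observer series law built on these is `…EGSeries.lean`.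
-/

noncomputable section

namespace Summit.CriticalPhenomena.PercolationContinuityZ3.Theorems

open MeasureTheory Set Literature.Probability.LatticeModels Literature.Probability.Percolation
open scoped Classical BigOperators

variable {n : ℕ}

namespace EGTransfer

open ChampionStability MergeStability RelayNbhd CILTwoSteiner

/-- `μ_{w⁰[s(o,x)↦1]}(EG-L_o) = μ_{w⁰}(EG-L_x)`: gluing the isolated `o` to `x`. [folklore] -/
theorem real_EGL_update_wzero_one (w : Sym2 (Fin n) → unitInterval) (A : Finset (Fin n)) (o x b : Fin n)
    (ho : o ∉ A) (hxo : x ≠ o) (hbo : b ≠ o) :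
    (prodBernoulli (Function.update (pinW w {e : Sym2 (Fin n) | o ∈ e ∧ ¬ e.IsDiag} ∅) s(o, x) 1)).real
        {ω : BondConfig (Fin n) | (∃ a ∈ A, ω ∈ openConn o a) ∧ ω ∉ openConn o b} =
      (prodBernoulli (pinW w {e : Sym2 (Fin n) | o ∈ e ∧ ¬ e.IsDiag} ∅)).real
        {ω : BondConfig (Fin n) | (∃ a ∈ A, ω ∈ openConn x a) ∧ ω ∉ openConn x b} := by
  haveI : ∀ u : Sym2 (Fin n) → unitInterval, IsProbabilityMeasure (prodBernoulli u) := fun u => inferInstance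
  have hox : o ≠ x := fun h => hxo h.symm
  rw [real_update_wzero_one w hxo]
  refine measureReal_congr_of_null _ _ _ {ω | ∀ u : Fin n, u ≠ o → s(o, u) ∉ ω}
    (real_compl_isolated_eq_zero w o) ?_
  ext ω
  simp only [mem_inter_iff, mem_setOf_eq, mem_preimage]
  constructor
  · rintro ⟨⟨⟨a, ha, hoa⟩, hob⟩, hω⟩
    have hao : a ≠ o := fun h => ho (h ▸ ha)
    have hoa' : (openGraph (insert s(o, x) ω)).Reachable o a := hoa
    refine ⟨⟨⟨a, ha, (reachable_o_insert_iff_of_isolated hox hω hao).1 hoa'⟩, fun hxb => hob ?_⟩, hω⟩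
    have hxb' : (openGraph ω).Reachable x b := hxb
    exact (reachable_o_insert_iff_of_isolated hox hω hbo).2 hxb'
  · rintro ⟨⟨⟨a, ha, hxa⟩, hxb⟩, hω⟩
    have hao : a ≠ o := fun h => ho (h ▸ ha)
    have hxa' : (openGraph ω).Reachable x a := hxa
    refine ⟨⟨⟨a, ha, (reachable_o_insert_iff_of_isolated hox hω hao).2 hxa'⟩, fun hob => hxb ?_⟩, hω⟩
    have hob' : (openGraph (insert s(o, x) ω)).Reachable o b := hob
    exact (reachable_o_insert_iff_of_isolated hox hω hbo).1 hob'

/-- `μ_{w⁰[s(o,x)↦1][s(o,y)↦1]}(EG-L_o) = μ_{w⁰[s(x,y)↦1]}(EG-L_x)` (any weight of the pair `x–y`). [folklore] -/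
theorem real_EGL_update_wzero_one_one (w : Sym2 (Fin n) → unitInterval) (A : Finset (Fin n)) (o x y b : Fin n)
    (ho : o ∉ A) (hxo : x ≠ o) (hyo : y ≠ o) (hxy : x ≠ y) (hbo : b ≠ o) :
    (prodBernoulli (Function.update (Function.update
        (pinW w {e : Sym2 (Fin n) | o ∈ e ∧ ¬ e.IsDiag} ∅) s(o, x) 1) s(o, y) 1)).real
        {ω : BondConfig (Fin n) | (∃ a ∈ A, ω ∈ openConn o a) ∧ ω ∉ openConn o b} =
      (prodBernoulli (Function.update (pinW w {e : Sym2 (Fin n) | o ∈ e ∧ ¬ e.IsDiag} ∅) s(x, y) 1)).real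
        {ω : BondConfig (Fin n) | (∃ a ∈ A, ω ∈ openConn x a) ∧ ω ∉ openConn x b} := by
  haveI : ∀ u : Sym2 (Fin n) → unitInterval, IsProbabilityMeasure (prodBernoulli u) := fun u => inferInstance
  have hox : o ≠ x := fun h => hxo h.symm
  have hoy : o ≠ y := fun h => hyo h.symm
  set w0 : Sym2 (Fin n) → unitInterval := pinW w {e : Sym2 (Fin n) | o ∈ e ∧ ¬ e.IsDiag} ∅ with hw0
  -- the `g`-insensitive event
  set E : Set (BondConfig (Fin n)) := {ω : BondConfig (Fin n) |
      (∃ a ∈ A, ω ∈ openConn x a ∨ ω ∈ openConn y a) ∧ ¬ (ω ∈ openConn x b ∨ ω ∈ openConn y b)} with hE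
  have hins : ∀ (ω : BondConfig (Fin n)) (z : Fin n),
      insert s(x, y) ω ∈ openConn x z ↔ (ω ∈ openConn x z ∨ ω ∈ openConn y z) :=
    fun ω z => ChampionStability.reachable_insert_left_iff ω hxy z
  have hins' : ∀ (ω : BondConfig (Fin n)) (z : Fin n),
      insert s(x, y) ω ∈ openConn y z ↔ (ω ∈ openConn y z ∨ ω ∈ openConn x z) := by
    intro ω z
    rw [Sym2.eq_swap]
    exact ChampionStability.reachable_insert_left_iff ω (Ne.symm hxy) z
  have hpreLx : (fun ω : BondConfig (Fin n) => insert s(x, y) ω) ⁻¹'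
      {ω : BondConfig (Fin n) | (∃ a ∈ A, ω ∈ openConn x a) ∧ ω ∉ openConn x b} = E := by
    ext ω
    simp only [mem_preimage, mem_setOf_eq, hE, hins]
  have hpreE : (fun ω : BondConfig (Fin n) => insert s(x, y) ω) ⁻¹' E = E := by
    ext ω
    simp only [mem_preimage, mem_setOf_eq, hE, hins, hins']
    constructor
    · rintro ⟨⟨a, ha, h⟩, hb⟩
      refine ⟨⟨a, ha, by tauto⟩, by tauto⟩
    · rintro ⟨⟨a, ha, h⟩, hb⟩
      refine ⟨⟨a, ha, by tauto⟩, by tauto⟩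
  have hR : (prodBernoulli (Function.update w0 s(x, y) 1)).real
      {ω : BondConfig (Fin n) | (∃ a ∈ A, ω ∈ openConn x a) ∧ ω ∉ openConn x b} =
      (prodBernoulli (Function.update w0 s(x, y) 0)).real E := by
    rw [tieLiftOne_real_one_eq w0 s(x, y), hpreLx]
  have hI : (prodBernoulli w0).real E = (prodBernoulli (Function.update w0 s(x, y) 0)).real E := by
    have h := stub_oneBondDecomp_k15 n w0 s(x, y) E
    rw [tieLiftOne_real_one_eq w0 s(x, y), hpreE] at h
    rw [h]; ring
  have hL : (prodBernoulli (Function.update (Function.update w0 s(o, x) 1) s(o, y) 1)).real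
      {ω : BondConfig (Fin n) | (∃ a ∈ A, ω ∈ openConn o a) ∧ ω ∉ openConn o b} = (prodBernoulli w0).real E := by
    rw [hw0, real_update_wzero_one_one w hxo hyo hxy, ← hw0]
    refine measureReal_congr_of_null _ _ _ {ω | ∀ u : Fin n, u ≠ o → s(o, u) ∉ ω}
      (by rw [hw0]; exact real_compl_isolated_eq_zero w o) ?_
    ext ω
    simp only [mem_inter_iff, mem_setOf_eq, hE]
    constructor
    · rintro ⟨⟨⟨a, ha, hoa⟩, hob⟩, hω⟩
      have hao : a ≠ o := fun h => ho (h ▸ ha)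
      have hoa' : (openGraph (insert s(o, y) (insert s(o, x) ω))).Reachable o a := hoa
      refine ⟨⟨⟨a, ha, (reachable_o_insert₂_iff_of_isolated hox hoy hω hao).1 hoa'⟩, fun hb => hob ?_⟩, hω⟩
      show (openGraph (insert s(o, y) (insert s(o, x) ω))).Reachable o b
      exact (reachable_o_insert₂_iff_of_isolated hox hoy hω hbo).2 hb
    · rintro ⟨⟨⟨a, ha, hxa⟩, hxb⟩, hω⟩
      have hao : a ≠ o := fun h => ho (h ▸ ha)
      refine ⟨⟨⟨a, ha, ?_⟩, fun hob => hxb ?_⟩, hω⟩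
      · show (openGraph (insert s(o, y) (insert s(o, x) ω))).Reachable o a
        exact (reachable_o_insert₂_iff_of_isolated hox hoy hω hao).2 hxa
      · have hob' : (openGraph (insert s(o, y) (insert s(o, x) ω))).Reachable o b := hob
        exact (reachable_o_insert₂_iff_of_isolated hox hoy hω hbo).1 hob'
  rw [hL, hR, hI]

/-- **The series-reduced graph has the same detachment law**: `μ_w(a ↮ b) = μ_{w₃}(a ↮ b)` for every `a ≠ o`
(`HullPort.series_reduction`, prover prim-hp-3, with terminal set `{b}`). [folklore: series law] -/
theorem detach_seriesReduced (w w₃ : Sym2 (Fin n) → unitInterval) (o x y b : Fin n)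
    (hxo : x ≠ o) (hyo : y ≠ o) (hxy : x ≠ y) (hbo : b ≠ o)
    (hiso : ∀ v : Fin n, v ≠ o → v ≠ x → v ≠ y → (w s(o, v) : ℝ) = 0)
    (h₃z : ∀ v : Fin n, v ≠ o → w₃ s(o, v) = 0) (h₃zz : w₃ s(o, o) = w s(o, o))
    (h₃off : ∀ e : Sym2 (Fin n), o ∉ e → e ≠ s(x, y) → w₃ e = w e)
    (h₃xy : (w₃ s(x, y) : ℝ) = 1 - (1 - (w s(x, y) : ℝ)) * (1 - (w s(o, x) : ℝ) * w s(o, y)))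
    (a : Fin n) (hao : a ≠ o) :
    (prodBernoulli w).real {ω : BondConfig (Fin n) | ω ∉ openConn a b} =
      (prodBernoulli w₃).real {ω : BondConfig (Fin n) | ω ∉ openConn a b} := by
  have hoB : o ∉ ({b} : Finset (Fin n)) := by
    rw [Finset.mem_singleton]; exact fun h => hbo h.symm
  have h := HullPort.series_reduction w w₃ ({b} : Finset (Fin n)) o x y hoB (fun h => hxo h.symm) (fun h => hyo h.symm)
    hxy (fun v hvo hvx hvy => Subtype.ext (hiso v hvo hvx hvy)) h₃z h₃zz h₃off h₃xy a hao
    (fun F => b ∉ F)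
  have hset : {ω : BondConfig (Fin n) | b ∉ ({b} : Finset (Fin n)).filter fun r => ω ∈ openConn a r} =
      {ω : BondConfig (Fin n) | ω ∉ openConn a b} := by
    ext ω
    simp only [mem_setOf_eq, Finset.mem_filter, Finset.mem_singleton, true_and]
  rw [hset] at h
  exact h

end EGTransfer

end Summit.CriticalPhenomena.PercolationContinuityZ3.Theorems

end
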